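import Mathlib
import Summits.MatrixMultiplication.MatrixMultiplication.Theorems.LieRankDesigns.Negative.Basics

/-!
# `LieRankDesigns` (stmt-MatrixMultiplication-7614), line `Sketch`: stub K `stub_frameFnLevel` — frame functions are level-`k` test functions

Crux `Summit.MatrixMultiplication.MatrixMultiplication.Theses.LevelGradedCohnUmans.LieRankDesigns`; skeleton
`Cruxes/LieRankDesigns/Lines/Sketch.lean` (lead prover-line-stmt-MatrixMultiplication-7614-0, registered stubs);
this file proves the registered stub `stub_frameFnLevel` verbatim (name + signature) and lands
`--supports stmt-MatrixMultiplication-7614`.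

Content (frame duality, easy half).  `G = GL_m(𝔽_p)`, `ψ = ZMod.stdAddChar`, `F_k` = functions
`g ↦ Σ_M c_M ψ(tr(M g))` with `c` supported on `rk M ≤ k` (`levelSet`).  For every kernel
`φ : M_{m×k} × M_{m×k} → ℂ` the "`k`-frame function" `g ↦ Σ_U φ_U(g U)` (`U` over `m × k` matrices) lies in
`F_k`: Fourier inversion on the finite abelian group `M_{m×k}(𝔽_p)` with dual variable `V ∈ M_{k×m}(𝔽_p)`
and pairing `tr(V X)` (`fourier_inversion`, from the orthogonality relation
`Σ_V ψ(tr(V D)) = p^{mk}·[D = 0]`, `sum_psi_trace_mul`) writes `φ_U(g U) = Σ_V a_{U,V} ψ(tr(V g U))`, and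
`tr(V g U) = tr((U V) g)` with `rk(U V) ≤ rk U ≤ k`; so `c_M := Σ_{U V = M} a_{U,V}` is a rank-`≤ k` table with
`Σ_U φ_U(g U) = Σ_M c_M ψ(tr(M g))` (`fourierFn_frameCoeff`, `rankSupp_frameCoeff`).
-/

set_option linter.dupNamespace false

noncomputable section

open scoped BigOperators
open Literature.RepresentationTheory.FiniteGroups
open Summit.MatrixMultiplication.MatrixMultiplication.Theorems.LieRankDesigns.Negative
  (GLm Mat fourierFn RankSupp RankSep levelSet budget volume)

namespace Summit.MatrixMultiplication.MatrixMultiplication.Theorems.LieRankDesigns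

namespace FrameFnLevel

variable {p m k : ℕ}

/-- `tr(V (g U)) = tr((U V) g)` for `U ∈ M_{m×k}`, `V ∈ M_{k×m}`, `g ∈ M_m`. [folklore] -/
theorem trace_frame (g : Mat p m) (U : Matrix (Fin m) (Fin k) (ZMod p))
    (V : Matrix (Fin k) (Fin m) (ZMod p)) :
    Matrix.trace (V * (g * U)) = Matrix.trace (U * V * g) := by
  rw [Matrix.trace_mul_comm, Matrix.mul_assoc, Matrix.trace_mul_comm]

variable [Fact p.Prime]

/-- The standard additive character `ψ` of `𝔽_p` turns finite sums into products. [folklore] -/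
-- adapted from Theorems/LieRankBeatsCubes/Negative/TopLevel.lean (`addChar_map_sum_eq_prod`)
theorem stdAddChar_map_sum {ι : Type*} (s : Finset ι) (x : ι → ZMod p) :
    (ZMod.stdAddChar (∑ i ∈ s, x i) : ℂ) = ∏ i ∈ s, ZMod.stdAddChar (x i) := by
  classical
  induction s using Finset.cons_induction with
  | empty => simp
  | cons a s ha ih => rw [Finset.sum_cons, Finset.prod_cons, AddChar.map_add_eq_mul, ih]

/-- **Orthogonality of the trace pairing `M_{k×m}(𝔽_p) × M_{m×k}(𝔽_p) → 𝔽_p`**: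
`Σ_{V ∈ M_{k×m}(𝔽_p)} ψ(tr(V D)) = p^{mk}·[D = 0]`. [folklore] -/
-- adapted from Theorems/LieRankBeatsCubes/Negative/TopLevel.lean (`sum_psi_trace_mul`, square case)
theorem sum_psi_trace_mul (D : Matrix (Fin m) (Fin k) (ZMod p)) :
    ∑ V : Matrix (Fin k) (Fin m) (ZMod p), ZMod.stdAddChar (Matrix.trace (V * D)) =
      if D = 0 then ((p : ℂ) ^ (m * k)) else 0 := by
  classical
  -- ψ(tr(V D)) = ∏_i ∏_j ψ(V i j * D j i)
  have hexp : ∀ V : Matrix (Fin k) (Fin m) (ZMod p), ZMod.stdAddChar (Matrix.trace (V * D)) =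
      ∏ i : Fin k, ∏ j : Fin m, ZMod.stdAddChar (V i j * D j i) := by
    intro V
    rw [Matrix.trace]
    simp only [Matrix.diag_apply, Matrix.mul_apply]
    rw [stdAddChar_map_sum]
    refine Finset.prod_congr rfl fun i _ => ?_
    rw [stdAddChar_map_sum]
  simp_rw [hexp]
  -- ∑_V ∏_i ∏_j f i j (V i j) = ∏_i ∏_j ∑_x f i j x
  have hswap : (∑ V : Matrix (Fin k) (Fin m) (ZMod p),
      ∏ i : Fin k, ∏ j : Fin m, ZMod.stdAddChar (V i j * D j i)) =
      ∏ i : Fin k, ∏ j : Fin m, ∑ x : ZMod p, ZMod.stdAddChar (x * D j i) := by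
    calc (∑ V : Matrix (Fin k) (Fin m) (ZMod p),
          ∏ i : Fin k, ∏ j : Fin m, ZMod.stdAddChar (V i j * D j i))
        = ∑ f : Fin k → Fin m → ZMod p,
            ∏ i : Fin k, ∏ j : Fin m, ZMod.stdAddChar (f i j * D j i) := by
          rw [← Equiv.sum_comp Matrix.of]
          rfl
      _ = ∏ i : Fin k, ∑ r : Fin m → ZMod p, ∏ j : Fin m, ZMod.stdAddChar (r j * D j i) :=
          (Fintype.prod_sum (fun (i : Fin k) (r : Fin m → ZMod p) =>
            ∏ j : Fin m, ZMod.stdAddChar (r j * D j i))).symm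
      _ = ∏ i : Fin k, ∏ j : Fin m, ∑ x : ZMod p, ZMod.stdAddChar (x * D j i) := by
          refine Finset.prod_congr rfl fun i _ => ?_
          exact (Fintype.prod_sum (fun (j : Fin m) (x : ZMod p) => ZMod.stdAddChar (x * D j i))).symm
  rw [hswap]
  have hinner : ∀ (i : Fin k) (j : Fin m), (∑ x : ZMod p, ZMod.stdAddChar (x * D j i)) =
      if D j i = 0 then (p : ℂ) else 0 := by
    intro i j
    rw [AddChar.sum_mulShift (D j i) (ZMod.isPrimitive_stdAddChar p), ZMod.card]
    split_ifs <;> simp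
  simp_rw [hinner]
  by_cases hD : D = 0
  · subst hD
    simp only [Matrix.zero_apply, if_true, Finset.prod_const, Finset.card_univ, Fintype.card_fin]
    rw [← pow_mul]
  · rw [if_neg hD]
    obtain ⟨j, i, hji⟩ : ∃ j i, D j i ≠ 0 := by
      by_contra hall
      push Not at hall
      exact hD (Matrix.ext fun j i => hall j i)
    exact Finset.prod_eq_zero (Finset.mem_univ i)
      (Finset.prod_eq_zero (Finset.mem_univ j) (by rw [if_neg hji]))

/-- **Fourier inversion on `M_{m×k}(𝔽_p)`**: `F(X₀) = Σ_V (p^{-mk} Σ_X F(X) ψ(-tr(V X))) ψ(tr(V X₀))`.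
[folklore] -/
-- adapted from Theorems/LieRankBeatsCubes/Negative/TopLevel.lean (`levelSet_eq_univ_of_le`)
theorem fourier_inversion (F : Matrix (Fin m) (Fin k) (ZMod p) → ℂ)
    (X₀ : Matrix (Fin m) (Fin k) (ZMod p)) :
    ∑ V : Matrix (Fin k) (Fin m) (ZMod p),
      (((p : ℂ) ^ (m * k))⁻¹ * ∑ X : Matrix (Fin m) (Fin k) (ZMod p),
          F X * ZMod.stdAddChar (Matrix.trace (V * (-X)))) *
        ZMod.stdAddChar (Matrix.trace (V * X₀)) = F X₀ := by
  classical
  have hp0 : ((p : ℂ) ^ (m * k)) ≠ 0 := pow_ne_zero _ (Nat.cast_ne_zero.mpr (NeZero.ne p))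
  have hexp : ∀ V : Matrix (Fin k) (Fin m) (ZMod p),
      (((p : ℂ) ^ (m * k))⁻¹ * ∑ X : Matrix (Fin m) (Fin k) (ZMod p),
          F X * ZMod.stdAddChar (Matrix.trace (V * (-X)))) *
        ZMod.stdAddChar (Matrix.trace (V * X₀)) =
      ((p : ℂ) ^ (m * k))⁻¹ * ∑ X : Matrix (Fin m) (Fin k) (ZMod p), F X *
        ZMod.stdAddChar (Matrix.trace (V * (X₀ - X))) := by
    intro V
    rw [mul_assoc, Finset.sum_mul]
    congr 1
    refine Finset.sum_congr rfl fun X _ => ?_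
    rw [mul_assoc, ← AddChar.map_add_eq_mul, ← Matrix.trace_add, ← Matrix.mul_add, neg_add_eq_sub]
  simp_rw [hexp]
  rw [← Finset.mul_sum, Finset.sum_comm]
  simp_rw [← Finset.mul_sum, sum_psi_trace_mul, sub_eq_zero, mul_ite, mul_zero]
  rw [Finset.sum_ite_eq, if_pos (Finset.mem_univ _), ← mul_assoc, mul_comm (((p : ℂ) ^ (m * k))⁻¹),
    mul_assoc, inv_mul_cancel₀ hp0, mul_one]

/-- The coefficient table `c_M := Σ_{U V = M} a_{U,V}` is supported on matrices of rank `≤ k`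
(`rk(U V) ≤ rk U ≤ k`, `U` having `k` columns). [folklore] -/
theorem rankSupp_frameCoeff
    (a : Matrix (Fin m) (Fin k) (ZMod p) → Matrix (Fin k) (Fin m) (ZMod p) → ℂ) :
    RankSupp (p := p) (m := m) k (fun M => ∑ U : Matrix (Fin m) (Fin k) (ZMod p),
      ∑ V : Matrix (Fin k) (Fin m) (ZMod p), if U * V = M then a U V else 0) := by
  intro M hM
  refine Finset.sum_eq_zero fun U _ => Finset.sum_eq_zero fun V _ => ?_
  rw [if_neg]
  rintro rfl
  exact absurd ((Matrix.rank_mul_le_left U V).trans (Matrix.rank_le_width U)) (not_le.mpr hM)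

/-- The Fourier function of the table `c_M := Σ_{U V = M} a_{U,V}` is `g ↦ Σ_U Σ_V a_{U,V} ψ(tr((U V) g))`
(reorganisation of finite sums). [folklore] -/
theorem fourierFn_frameCoeff
    (a : Matrix (Fin m) (Fin k) (ZMod p) → Matrix (Fin k) (Fin m) (ZMod p) → ℂ) (g : GLm p m) :
    fourierFn (fun M => ∑ U : Matrix (Fin m) (Fin k) (ZMod p),
      ∑ V : Matrix (Fin k) (Fin m) (ZMod p), if U * V = M then a U V else 0) g =
    ∑ U : Matrix (Fin m) (Fin k) (ZMod p), ∑ V : Matrix (Fin k) (Fin m) (ZMod p),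
      a U V * ZMod.stdAddChar (Matrix.trace (U * V * (g : Mat p m))) := by
  classical
  unfold fourierFn
  simp_rw [Finset.sum_mul, ite_mul, zero_mul]
  rw [Finset.sum_comm]
  refine Finset.sum_congr rfl fun U _ => ?_
  rw [Finset.sum_comm]
  refine Finset.sum_congr rfl fun V _ => ?_
  rw [Finset.sum_ite_eq, if_pos (Finset.mem_univ _)]

end FrameFnLevel

open FrameFnLevel in
/-- **Stub K `FrameFnLevel`** (registered signature; frame duality, easy half).  Every `k`-frame function
`g ↦ Σ_U φ_U(g U)` (`U` over `M_{m×k}(𝔽_p)`) is a level-`k` test function: it equals `Σ_M c_M ψ(tr(M g))`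
with `c_M = Σ_{U V = M} p^{-mk} Σ_X φ_U(X) ψ(-tr(V X))` (Fourier inversion of `φ_U` on `M_{m×k}(𝔽_p)`,
`fourier_inversion`, and `tr(V g U) = tr((U V) g)`), a table vanishing when `rk M > k ≥ rk(U V)`. -/
theorem stub_frameFnLevel :
    ∀ (p m k : ℕ) [Fact p.Prime] (φ : Matrix (Fin m) (Fin k) (ZMod p) → Matrix (Fin m) (Fin k) (ZMod p) → ℂ),
      (fun g : GLm p m => ∑ U : Matrix (Fin m) (Fin k) (ZMod p), φ U ((g : Mat p m) * U)) ∈ levelSet p m k := by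
  intro p m k _ φ
  classical
  refine ⟨fun M => ∑ U : Matrix (Fin m) (Fin k) (ZMod p), ∑ V : Matrix (Fin k) (Fin m) (ZMod p),
      if U * V = M then ((p : ℂ) ^ (m * k))⁻¹ * ∑ X : Matrix (Fin m) (Fin k) (ZMod p),
        φ U X * ZMod.stdAddChar (Matrix.trace (V * (-X))) else 0,
    rankSupp_frameCoeff _, fun g => ?_⟩
  rw [fourierFn_frameCoeff]
  refine Finset.sum_congr rfl fun U _ => ?_
  rw [← fourier_inversion (φ U) ((g : Mat p m) * U)]
  refine Finset.sum_congr rfl fun V _ => ?_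
  rw [trace_frame]

end Summit.MatrixMultiplication.MatrixMultiplication.Theorems.LieRankDesigns

end
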